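import Summits.Ventures.HSemireg.WedgeHankelDivisorRank
import Summits.Ventures.HSemireg.WedgeHankelSwap

/-!
# Venture HSemireg — THE DIVISOR RANK LAW ON `P¹`: finite nodes `λ_i` of orders `P_i + 1` AND the node `∞` of order `P∞ + 1` —
# `rank H_k(Σ_i expMul λ_i q_i + rev_n q∞) = Σ_i (P_i + 1) + (P∞ + 1)` for total order `≤ min(k + 1, n + 1 − k)`

HONEST FRAMING. Part of the Lean index of the computation cell `pub-hsemireg` (seat p10 gen 16, Sunday typer «UNIFORM-IN-n»).
LINEAR ALGEBRA OF HANKEL (catalecticant) MATRICES over a field ONLY: no variety, no cohomology theory, no sheaf, no Ext group, no semiregularity map;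
nothing here says that HC / HC_CM / HC_AV holds; no Literature fact is declared or used.  Custodian versions as in `WedgeHankelSiegelIdeal` (1/3) and
`WedgeHankelFrameChange`; the dictionary (the top window `rev_n q∞` ↦ an order-`(P∞+1)` node at `∞`; the divisor `Σ_i (P_i+1)[λ_i] + (P∞+1)[∞]`) is QUOTED, never asserted.

WHAT IS IN THE TREE / KEYED.  F2a `WedgeHankelDivisorRank` (finite divisors: independence `expMul_sum_eq_zero`, `H = Cᵀ·Hk·C`, rank `= D`); E7 `rev` (the node at `∞` is the reversal of a
node at `0`); E10 (one finite node of any order + `∞`).  THIS FILE adds the node at `∞` to F2a's linear algebra (no transport, so no «free point» hypothesis on `K`):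
* §59 **INDEPENDENCE WITH A TOP WINDOW `expMul_sum_add_top_eq_zero`**: if `Σ_i expMul λ_i q_i + t` vanishes on `[0, c)` with `q_i` supported on `[0, m_i)`, `t` vanishing below
  `c − P∞ − 1`, and `Σ_i m_i + P∞ + 1 ≤ c`, then every `q_i = 0` (and then `t` vanishes on the window) — F2a's induction with the top window riding along.
* §60 the node-`∞` matrices: `topMat P∞ c` (`(t, l) ↦ [l + t + 1 = c]`) and `hk1 q∞` (`(t,t′) ↦ q∞(t+t′)`); the `P¹` node matrix `cvMatT := fromRows cvMat topMat` and
  `hkMatT := fromBlocks hkMat 0 0 hk1`; **`hankel1_expMul_sum_add_rev`: `H_k(Σ_i expMul λ_i q_i + rev_n q∞) = (cvMatT (k+1))ᵀ · hkMatT · cvMatT (n+1−k)`** (`k ≤ n`).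
* §61 `(cvMatT c)ᵀ` injective and `cvMatT c` onto for `D ≤ c` (§59), `hkMatT` injective for exact orders; **THE `P¹` DIVISOR RANK LAW `rank_hankel1_expMul_sum_add_rev`:
  `rank H_k = Σ_i (P_i+1) + (P∞+1)` for distinct `λ_i`, exact orders, `D ≤ k + 1`, `D ≤ n + 1 − k`** (E10's `P + P′ + 2` = one finite node + `∞`).
NOT typed here: the full-row-rank regime with `∞` (column truncation as in F2c); the kernel NAME (next leaf: `⋂_i (SI ⊔ Φs λ_i xRich) ∩ (SI ⊔ yRich(k, P∞))`).
Namespace `Summit.Ventures.HSemireg.Wedge.HankelFrameChange` (continued); new names only.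
-/

open Module
open scoped Matrix

namespace Summit.Ventures.HSemireg.Wedge.HankelFrameChange

open Summit.Ventures.HSemireg.Wedge Summit.Ventures.HSemireg.Wedge.Hankel

variable (K : Type*) [Field K]

/-! ## §59. Independence with a top window -/

/-- the binomial transform of the zero sequence is zero. -/
lemma expMul_eq_zero_of_forall (lam : K) {q : ℕ → K} (hq : ∀ i, q i = 0) (j : ℕ) : expMul K lam q j = 0 := by
  rw [expMul_eq_sum]
  exact Finset.sum_eq_zero fun i _ => by rw [hq i, mul_zero]


/-- **INDEPENDENCE OF CONFLUENT EXPONENTIAL SEQUENCES PLUS A TOP WINDOW**: distinct `λ_i`, `q_i` supported on `[0, m_i)`, `D = Σ_i m_i`, `t` vanishing below `c − P∞ − 1`,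
`D + P∞ + 1 ≤ c`; if `Σ_i expMul λ_i q_i + t` vanishes on `[0, c)` then every `q_i = 0`. -/
theorem expMul_sum_add_top_eq_zero {r : ℕ} {lam : Fin r → K} (hlam : Function.Injective lam) (Pinf : ℕ) :
    ∀ (D : ℕ) (m : Fin r → ℕ) (q : Fin r → ℕ → K) (t : ℕ → K) (c : ℕ), ∑ i, m i = D → (∀ i j, m i ≤ j → q i j = 0) →
      (∀ j, j + Pinf + 1 < c → t j = 0) → D + Pinf + 1 ≤ c →
      (∀ j, j < c → (∑ i, expMul K (lam i) (q i) j) + t j = 0) → ∀ i j, q i j = 0 := by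
  intro D
  induction D with
  | zero =>
    intro m q t c hD hq _ _ _ i j
    have hm : m i = 0 := (Finset.sum_eq_zero_iff.mp hD) i (Finset.mem_univ i)
    exact hq i j (by omega)
  | succ D ih =>
    intro m q t c hD hq ht hc h0
    obtain ⟨i₀, hi₀⟩ : ∃ i₀, 0 < m i₀ := by
      by_contra hcon
      have : ∑ i, m i = 0 := Finset.sum_eq_zero fun i _ => Nat.le_zero.mp (not_lt.mp (fun h => hcon ⟨i, h⟩))
      omega
    set q' : Fin r → ℕ → K := fun i j => (lam i - lam i₀) * q i j + q i (j + 1) with hq'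
    set m' : Fin r → ℕ := Function.update m i₀ (m i₀ - 1) with hm'
    set t' : ℕ → K := fun j => t (j + 1) - lam i₀ * t j with ht'
    have hD' : ∑ i, m' i = D := by
      have h1 : ∑ i, m' i = (m i₀ - 1) + ∑ x ∈ Finset.univ.erase i₀, m x := by
        rw [hm', Finset.sum_update_of_mem (Finset.mem_univ i₀), Finset.sdiff_singleton_eq_erase]
      have h2 : m i₀ + ∑ x ∈ Finset.univ.erase i₀, m x = ∑ i, m i := Finset.add_sum_erase _ _ (Finset.mem_univ i₀)
      omega
    have hq'supp : ∀ i j, m' i ≤ j → q' i j = 0 := by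
      intro i j hj
      simp only [hq']
      by_cases hi : i = i₀
      · subst hi
        rw [hm', Function.update_self] at hj
        rw [sub_self, zero_mul, zero_add, hq _ _ (by omega)]
      · rw [hm', Function.update_of_ne hi] at hj
        rw [hq _ _ hj, hq _ _ (by omega), mul_zero, add_zero]
    have ht'supp : ∀ j, j + Pinf + 1 < c - 1 → t' j = 0 := by
      intro j hj
      simp only [ht']
      rw [ht _ (by omega), ht _ (by omega), mul_zero, sub_zero]
    have h0' : ∀ j, j < c - 1 → (∑ i, expMul K (lam i) (q' i) j) + t' j = 0 := by
      intro j hj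
      have e : ∑ i, expMul K (lam i) (q' i) j = ∑ i, expMul K (lam i) (q i) (j + 1) - lam i₀ * ∑ i, expMul K (lam i) (q i) j := by
        rw [Finset.mul_sum, ← Finset.sum_sub_distrib]
        exact Finset.sum_congr rfl fun i _ => expMul_shear_seq K _ _ _ _
      have h1 := h0 (j + 1) (by omega)
      have h2 := h0 j (by omega)
      rw [e]; simp only [ht']
      linear_combination h1 - lam i₀ * h2
    have hz := ih m' q' t' (c - 1) hD' hq'supp ht'supp (by omega) h0'
    have hoth : ∀ i, i ≠ i₀ → ∀ j, q i j = 0 := fun i hi =>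
      seq_eq_zero_of_shear_eq_zero K (fun e => hi (hlam e)) (hq i) (fun j => hz i j)
    have hi₀succ : ∀ j, q i₀ (j + 1) = 0 := fun j => by
      have := hz i₀ j; simp only [hq', sub_self, zero_mul, zero_add] at this; exact this
    have hi₀zero : q i₀ 0 = 0 := by
      have h00 := h0 0 (by omega)
      rw [Finset.sum_eq_single i₀ (fun i _ hi => by rw [expMul_zero, hoth i hi]) (fun h => absurd (Finset.mem_univ i₀) h),
        expMul_zero, ht 0 (by omega), add_zero] at h00
      exact h00
    intro i j
    by_cases hi : i = i₀
    · subst hi; cases j with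
      | zero => exact hi₀zero
      | succ j => exact hi₀succ j
    · exact hoth i hi j

/-- … and then the top window vanishes on the window too. -/
theorem top_eq_zero_of_expMul_sum_add_top_eq_zero {r : ℕ} {lam : Fin r → K} (hlam : Function.Injective lam) (Pinf : ℕ) {m : Fin r → ℕ}
    {q : Fin r → ℕ → K} {t : ℕ → K} {c : ℕ} (hq : ∀ i j, m i ≤ j → q i j = 0) (ht : ∀ j, j + Pinf + 1 < c → t j = 0) (hc : ∑ i, m i + Pinf + 1 ≤ c)
    (h0 : ∀ j, j < c → (∑ i, expMul K (lam i) (q i) j) + t j = 0) : ∀ j, j < c → t j = 0 := by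
  have hz := expMul_sum_add_top_eq_zero K hlam Pinf _ m q t c rfl hq ht hc h0
  intro j hj
  have h := h0 j hj
  rw [Finset.sum_eq_zero (fun i _ => expMul_eq_zero_of_forall K (lam i) (hz i) j), zero_add] at h
  exact h

/-! ## §60. The node at `∞`: matrices and the factorization -/

/-- **THE NODE-`∞` MATRIX** `topMat P∞ c : (t, l) ↦ [l + t + 1 = c]` — row `t` is the unit vector at the column `c − 1 − t`. -/
def topMat (Pinf c : ℕ) : Matrix (Fin (Pinf + 1)) (Fin c) K := Matrix.of fun t l => if (l : ℕ) + (t : ℕ) + 1 = c then 1 else 0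

/-- the coefficient block of the node at `∞`: `(t, t′) ↦ q∞(t + t′)`. -/
def hk1 (Pinf : ℕ) (qinf : ℕ → K) : Matrix (Fin (Pinf + 1)) (Fin (Pinf + 1)) K := Matrix.of fun t t' => qinf ((t : ℕ) + (t' : ℕ))

/-- entries of `topMat`. -/
lemma topMat_apply (Pinf c : ℕ) (t : Fin (Pinf + 1)) (l : Fin c) : topMat K Pinf c t l = if (l : ℕ) + (t : ℕ) + 1 = c then 1 else 0 := rfl

omit [Field K] in
/-- entries of `hk1`. -/
lemma hk1_apply (Pinf : ℕ) (qinf : ℕ → K) (t t' : Fin (Pinf + 1)) : hk1 K Pinf qinf t t' = qinf ((t : ℕ) + (t' : ℕ)) := rfl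

/-- the zero-extension to `ℕ` of a vector on `Fin (P∞ + 1)`. -/
def extTop {Pinf : ℕ} (f : Fin (Pinf + 1) → K) : ℕ → K := fun u => if h : u < Pinf + 1 then f ⟨u, h⟩ else 0

/-- `extTop f` beyond the block. -/
lemma extTop_apply_of_lt {Pinf : ℕ} (f : Fin (Pinf + 1) → K) {u : ℕ} (hu : Pinf < u) : extTop K f u = 0 := by rw [extTop, dif_neg (by omega)]

/-- `extTop f` on the block. -/
lemma extTop_apply_fin {Pinf : ℕ} (f : Fin (Pinf + 1) → K) (t : Fin (Pinf + 1)) : extTop K f t = f t := by rw [extTop, dif_pos t.2]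

/-- **a row of `topMat` picks one entry**: `Σ_t [a + t + 1 = c] · f t = (extTop f)(c − 1 − a)`. -/
lemma sum_topMat_mul {Pinf c : ℕ} (a : Fin c) (f : Fin (Pinf + 1) → K) :
    ∑ t : Fin (Pinf + 1), topMat K Pinf c t a * f t = extTop K f (c - 1 - (a : ℕ)) := by
  have ha := a.2
  by_cases h : c - 1 - (a : ℕ) < Pinf + 1
  · rw [Finset.sum_eq_single ⟨c - 1 - (a : ℕ), h⟩]
    · rw [topMat_apply, if_pos (by simp; omega), one_mul, extTop, dif_pos h]
    · intro t _ ht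
      rw [topMat_apply, if_neg (fun e => ht (Fin.ext (by simp; omega))), zero_mul]
    · intro hh; exact absurd (Finset.mem_univ _) hh
  · rw [extTop, dif_neg h]
    exact Finset.sum_eq_zero fun t _ => by rw [topMat_apply, if_neg (by have := t.2; omega), zero_mul]

/-- … the same with the factor on the left. -/
lemma sum_mul_topMat {Pinf c : ℕ} (a : Fin c) (f : Fin (Pinf + 1) → K) :
    ∑ t : Fin (Pinf + 1), f t * topMat K Pinf c t a = extTop K f (c - 1 - (a : ℕ)) := by
  rw [← sum_topMat_mul]; exact Finset.sum_congr rfl fun t _ => mul_comm _ _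

/-- **THE FACTORIZATION FOR THE NODE AT `∞`: `H_k(rev_n q∞) = (topMat (k+1))ᵀ · hk1 q∞ · topMat (n+1−k)`** for `q∞` supported on `[0, P∞]` and `k ≤ n`. -/
theorem hankel1_rev (n k : ℕ) (hk : k ≤ n) {Pinf : ℕ} {qinf : ℕ → K} (hq : ∀ j, Pinf < j → qinf j = 0) :
    hankel1 K n k (rev K n qinf) = (topMat K Pinf (k + 1))ᵀ * hk1 K Pinf qinf * topMat K Pinf (n + 1 - k) := by
  ext a b
  have ha := a.2; have hb := b.2
  rw [hankel1, Matrix.of_apply, rev_apply_of_le K (show (a : ℕ) + (b : ℕ) ≤ n by omega), Matrix.mul_apply]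
  simp only [Matrix.mul_apply, Matrix.transpose_apply, hk1_apply]
  have e : ∀ t' : Fin (Pinf + 1), (∑ t : Fin (Pinf + 1), topMat K Pinf (k + 1) t a * qinf ((t : ℕ) + (t' : ℕ))) * topMat K Pinf (n + 1 - k) t' b =
      extTop K (fun t : Fin (Pinf + 1) => qinf ((t : ℕ) + (t' : ℕ))) (k - (a : ℕ)) * topMat K Pinf (n + 1 - k) t' b := by
    intro t'; rw [sum_topMat_mul, show k + 1 - 1 - (a : ℕ) = k - (a : ℕ) by omega]
  rw [Finset.sum_congr rfl fun t' _ => e t', sum_mul_topMat, show n + 1 - k - 1 - (b : ℕ) = n - k - (b : ℕ) by omega]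
  -- unfold the two zero-extensions
  by_cases h1 : n - k - (b : ℕ) < Pinf + 1
  · rw [extTop, dif_pos h1]
    by_cases h2 : k - (a : ℕ) < Pinf + 1
    · rw [extTop, dif_pos h2]; congr 1; simp; omega
    · rw [extTop, dif_neg h2, hq _ (by omega)]
  · rw [extTop, dif_neg h1, hq _ (by omega)]

/-- the Hankel matrix is additive in the sequence. -/
lemma hankel1_add' (n k : ℕ) (q q' : ℕ → K) : hankel1 K n k (fun j => q j + q' j) = hankel1 K n k q + hankel1 K n k q' := by
  ext a b; simp [hankel1]

/-- **THE `P¹` NODE MATRIX**: the confluent node matrix of the finite nodes stacked over the node-`∞` matrix. -/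
def cvMatT {r : ℕ} (lam : Fin r → K) (P : Fin r → ℕ) (Pinf c : ℕ) : Matrix (DIdx P ⊕ Fin (Pinf + 1)) (Fin c) K :=
  Matrix.fromRows (cvMat K lam P c) (topMat K Pinf c)

/-- **THE `P¹` COEFFICIENT MATRIX**: block diagonal, the finite blocks and the `∞` block. -/
def hkMatT {r : ℕ} (P : Fin r → ℕ) (q : Fin r → ℕ → K) (Pinf : ℕ) (qinf : ℕ → K) :
    Matrix (DIdx P ⊕ Fin (Pinf + 1)) (DIdx P ⊕ Fin (Pinf + 1)) K :=
  Matrix.fromBlocks (hkMat K P q) 0 0 (hk1 K Pinf qinf)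

/-- the block product: `(cvMatT c₁)ᵀ · hkMatT · cvMatT c₂ = cvMatᵀ · hkMat · cvMat + topMatᵀ · hk1 · topMat`. -/
theorem cvMatT_transpose_mul_hkMatT_mul {r : ℕ} (lam : Fin r → K) (P : Fin r → ℕ) (q : Fin r → ℕ → K) (Pinf : ℕ) (qinf : ℕ → K) (c₁ c₂ : ℕ) :
    (cvMatT K lam P Pinf c₁)ᵀ * hkMatT K P q Pinf qinf * cvMatT K lam P Pinf c₂ =
      (cvMat K lam P c₁)ᵀ * hkMat K P q * cvMat K lam P c₂ + (topMat K Pinf c₁)ᵀ * hk1 K Pinf qinf * topMat K Pinf c₂ := by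
  rw [cvMatT, cvMatT, hkMatT, Matrix.transpose_fromRows, Matrix.fromCols_mul_fromBlocks, Matrix.fromCols_mul_fromRows]
  simp

/-- **THE FACTORIZATION ON `P¹`: `H_k(Σ_i expMul λ_i q_i + rev_n q∞) = (cvMatT (k+1))ᵀ · hkMatT · cvMatT (n+1−k)`** (`k ≤ n`; `q_i`, `q∞` supported on `[0, P_i]`, `[0, P∞]`). -/
theorem hankel1_expMul_sum_add_rev (n k : ℕ) (hk : k ≤ n) {r : ℕ} (lam : Fin r → K) {P : Fin r → ℕ} {q : Fin r → ℕ → K}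
    (hq : ∀ i j, P i < j → q i j = 0) {Pinf : ℕ} {qinf : ℕ → K} (hqinf : ∀ j, Pinf < j → qinf j = 0) :
    hankel1 K n k (fun j => (∑ i, expMul K (lam i) (q i) j) + rev K n qinf j) =
      (cvMatT K lam P Pinf (k + 1))ᵀ * hkMatT K P q Pinf qinf * cvMatT K lam P Pinf (n + 1 - k) := by
  rw [cvMatT_transpose_mul_hkMatT_mul, hankel1_add', hankel1_expMul_sum K n k lam hq, hankel1_rev K n k hk hqinf]

/-! ## §61. The three factors on `P¹` and the rank law -/

/-- `|DIdx P ⊕ Fin (P∞+1)| = Σ_i (P_i + 1) + (P∞ + 1)`. -/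
lemma card_DIdx_sum {r : ℕ} (P : Fin r → ℕ) (Pinf : ℕ) : Fintype.card (DIdx P ⊕ Fin (Pinf + 1)) = ∑ i, (P i + 1) + (Pinf + 1) := by
  rw [Fintype.card_sum, card_DIdx, Fintype.card_fin]

/-- `(cvMatT c)ᵀ w` at column `l`: the finite divisor sequence of `w ∘ inl` plus the top window `t ↦ w (inr ·)` placed at the top of `[0, c)`. -/
lemma cvMatT_transpose_mulVec {r : ℕ} (lam : Fin r → K) (P : Fin r → ℕ) (Pinf c : ℕ) (w : DIdx P ⊕ Fin (Pinf + 1) → K) (l : Fin c) :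
    ((cvMatT K lam P Pinf c)ᵀ *ᵥ w) l =
      (∑ i, expMul K (lam i) (extSeq K (fun x => w (Sum.inl x)) i) l) + extTop K (fun t => w (Sum.inr t)) (c - 1 - (l : ℕ)) := by
  rw [Matrix.mulVec, dotProduct, Fintype.sum_sum_type]
  congr 1
  · rw [← cvMat_transpose_mulVec K lam P c (fun x => w (Sum.inl x)) l, Matrix.mulVec, dotProduct]
    rfl
  · rw [← sum_topMat_mul]
    rfl

/-- **`(cvMatT c)ᵀ` IS INJECTIVE for `Σ_i (P_i+1) + (P∞+1) ≤ c`** (§59). -/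
theorem cvMatT_transpose_mulVecLin_injective {r : ℕ} {lam : Fin r → K} (hlam : Function.Injective lam) (P : Fin r → ℕ) (Pinf : ℕ) {c : ℕ}
    (hc : ∑ i, (P i + 1) + (Pinf + 1) ≤ c) : Function.Injective (cvMatT K lam P Pinf c)ᵀ.mulVecLin := by
  rw [← LinearMap.ker_eq_bot, LinearMap.ker_eq_bot']
  intro w hw
  set t : ℕ → K := fun j => extTop K (fun t => w (Sum.inr t)) (c - 1 - j) with htdef
  have ht : ∀ j, j + Pinf + 1 < c → t j = 0 := fun j hj => by
    simp only [htdef]; exact extTop_apply_of_lt K _ (by omega)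
  have h0 : ∀ j, j < c → (∑ i, expMul K (lam i) (extSeq K (fun x => w (Sum.inl x)) i) j) + t j = 0 := fun j hj => by
    have := congrFun hw ⟨j, hj⟩
    rwa [Matrix.mulVecLin_apply, cvMatT_transpose_mulVec] at this
  have hzq := expMul_sum_add_top_eq_zero K hlam Pinf _ (fun i => P i + 1) _ t c rfl
    (fun i j hj => extSeq_apply_of_lt K _ i (by omega)) ht (by omega) h0
  have hzt := top_eq_zero_of_expMul_sum_add_top_eq_zero K hlam Pinf (m := fun i => P i + 1)
    (fun i j hj => extSeq_apply_of_lt K _ i (by omega)) ht (by show ∑ i, (P i + 1) + Pinf + 1 ≤ c; omega) h0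
  funext x
  rcases x with x | s
  · obtain ⟨i, u⟩ := x
    rw [← extSeq_apply_fin K (fun x => w (Sum.inl x)) i u, hzq, Pi.zero_apply]
  · have hs := s.2
    have := hzt (c - 1 - (s : ℕ)) (by omega)
    simp only [htdef] at this
    rw [show c - 1 - (c - 1 - (s : ℕ)) = (s : ℕ) by omega, extTop_apply_fin] at this
    rw [this, Pi.zero_apply]

/-- so `cvMatT c` has rank `D` … -/
theorem rank_cvMatT {r : ℕ} {lam : Fin r → K} (hlam : Function.Injective lam) (P : Fin r → ℕ) (Pinf : ℕ) {c : ℕ}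
    (hc : ∑ i, (P i + 1) + (Pinf + 1) ≤ c) : (cvMatT K lam P Pinf c).rank = ∑ i, (P i + 1) + (Pinf + 1) := by
  rw [← Matrix.rank_transpose, Matrix.rank, LinearMap.finrank_range_of_inj (cvMatT_transpose_mulVecLin_injective K hlam P Pinf hc),
    finrank_fintype_fun_eq_card, card_DIdx_sum]

/-- … and is onto `K^D`. -/
theorem range_cvMatT_mulVecLin_eq_top {r : ℕ} {lam : Fin r → K} (hlam : Function.Injective lam) (P : Fin r → ℕ) (Pinf : ℕ) {c : ℕ}
    (hc : ∑ i, (P i + 1) + (Pinf + 1) ≤ c) : LinearMap.range (cvMatT K lam P Pinf c).mulVecLin = ⊤ := by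
  apply Submodule.eq_top_of_finrank_eq
  rw [← Matrix.rank, rank_cvMatT K hlam P Pinf hc, finrank_fintype_fun_eq_card, card_DIdx_sum]

/-- **`hk1 q∞` IS INJECTIVE for `q∞` of exact order `P∞`** (anti-triangular with `q∞(P∞) ≠ 0` on the anti-diagonal). -/
theorem hk1_mulVecLin_injective (Pinf : ℕ) {qinf : ℕ → K} (hq : ∀ j, Pinf < j → qinf j = 0) (hqP : qinf Pinf ≠ 0) :
    Function.Injective (hk1 K Pinf qinf).mulVecLin := by
  rw [← LinearMap.ker_eq_bot, LinearMap.ker_eq_bot']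
  intro v hv
  have hrow : ∀ t : Fin (Pinf + 1), ∑ t' : Fin (Pinf + 1), qinf ((t : ℕ) + (t' : ℕ)) * v t' = 0 := fun t => by
    have := congrFun hv t
    rw [Matrix.mulVecLin_apply, Pi.zero_apply, Matrix.mulVec, dotProduct] at this
    simp only [hk1_apply] at this
    exact this
  have key : ∀ (d : ℕ) (hd : d < Pinf + 1), v ⟨d, hd⟩ = 0 := by
    intro d
    induction d using Nat.strong_induction_on with
    | _ d IH =>
      intro hd
      have h := hrow ⟨Pinf - d, by omega⟩
      rw [Finset.sum_eq_single ⟨d, hd⟩] at h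
      · rw [show ((⟨Pinf - d, by omega⟩ : Fin (Pinf + 1)) : ℕ) + ((⟨d, hd⟩ : Fin (Pinf + 1)) : ℕ) = Pinf by simp; omega] at h
        exact (mul_eq_zero.mp h).resolve_left hqP
      · intro t' _ ht'
        by_cases hlt : (t' : ℕ) < d
        · have h1 := IH t' hlt t'.2
          rw [Fin.eta] at h1
          rw [h1, mul_zero]
        · have hne : (t' : ℕ) ≠ d := fun e => ht' (Fin.ext e)
          rw [hq _ (by simp; omega), zero_mul]
      · intro h; exact absurd (Finset.mem_univ _) h
  funext t
  have := key t t.2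
  rwa [Fin.eta] at this

/-- **`hkMatT` IS INJECTIVE for exact orders** (block diagonal: F2a's `hkMat` and `hk1`). -/
theorem hkMatT_mulVecLin_injective {r : ℕ} (P : Fin r → ℕ) {q : Fin r → ℕ → K} (hq : ∀ i j, P i < j → q i j = 0) (hqP : ∀ i, q i (P i) ≠ 0)
    (Pinf : ℕ) {qinf : ℕ → K} (hqi : ∀ j, Pinf < j → qinf j = 0) (hqiP : qinf Pinf ≠ 0) :
    Function.Injective (hkMatT K P q Pinf qinf).mulVecLin := by
  rw [← LinearMap.ker_eq_bot, LinearMap.ker_eq_bot']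
  intro v hv
  rw [Matrix.mulVecLin_apply, hkMatT, Matrix.fromBlocks_mulVec] at hv
  have h1 : hkMat K P q *ᵥ (v ∘ Sum.inl) = 0 := by
    funext x; have := congrFun hv (Sum.inl x); simpa using this
  have h2 : hk1 K Pinf qinf *ᵥ (v ∘ Sum.inr) = 0 := by
    funext t; have := congrFun hv (Sum.inr t); simpa using this
  have hz1 : (v ∘ Sum.inl) = 0 :=
    hkMat_mulVecLin_injective K P hq hqP (by rw [Matrix.mulVecLin_apply, h1, map_zero])
  have hz2 : (v ∘ Sum.inr) = 0 :=
    hk1_mulVecLin_injective K Pinf hqi hqiP (by rw [Matrix.mulVecLin_apply, h2, map_zero])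
  funext x
  rcases x with x | t
  · exact congrFun hz1 x
  · exact congrFun hz2 t

/-- **THE `P¹` DIVISOR RANK LAW: `rank H_k(Σ_i expMul λ_i q_i + rev_n q∞) = Σ_i (P_i + 1) + (P∞ + 1)`** for distinct finite nodes `λ_i` of exact orders `P_i`, a node at `∞`
of exact order `P∞` (`q∞` supported on `[0, P∞]`, `q∞(P∞) ≠ 0`, entering as the top window `rev_n q∞`), and total order `D ≤ k + 1`, `D ≤ n + 1 − k`. -/
theorem rank_hankel1_expMul_sum_add_rev {n k r : ℕ} {lam : Fin r → K} (hlam : Function.Injective lam) {P : Fin r → ℕ} {q : Fin r → ℕ → K}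
    (hq : ∀ i j, P i < j → q i j = 0) (hqP : ∀ i, q i (P i) ≠ 0) {Pinf : ℕ} {qinf : ℕ → K} (hqi : ∀ j, Pinf < j → qinf j = 0) (hqiP : qinf Pinf ≠ 0)
    (hDk : ∑ i, (P i + 1) + (Pinf + 1) ≤ k + 1) (hDn : ∑ i, (P i + 1) + (Pinf + 1) ≤ n + 1 - k) :
    (hankel1 K n k (fun j => (∑ i, expMul K (lam i) (q i) j) + rev K n qinf j)).rank = ∑ i, (P i + 1) + (Pinf + 1) := by
  have hinj : Function.Injective ((cvMatT K lam P Pinf (k + 1))ᵀ.mulVecLin ∘ₗ (hkMatT K P q Pinf qinf).mulVecLin) := by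
    rw [LinearMap.coe_comp]
    exact (cvMatT_transpose_mulVecLin_injective K hlam P Pinf hDk).comp (hkMatT_mulVecLin_injective K P hq hqP Pinf hqi hqiP)
  rw [hankel1_expMul_sum_add_rev K n k (by omega) lam hq hqi, Matrix.rank, Matrix.mulVecLin_mul,
    LinearMap.range_comp_of_range_eq_top _ (range_cvMatT_mulVecLin_eq_top K hlam P Pinf hDn), Matrix.mulVecLin_mul,
    LinearMap.finrank_range_of_inj hinj, finrank_fintype_fun_eq_card, card_DIdx_sum]

end Summit.Ventures.HSemireg.Wedge.HankelFrameChange
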